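import Mathlib
import Literature.Probability.Percolation.ProdBernoulliRusso
import Summits.CriticalPhenomena.CardyFormulaZ2.Theorems.CardyMagicRigidityHexSegmentDefs
import Summits.CriticalPhenomena.CardyFormulaZ2.Theorems.CardyMagicRigidityLoopLimitZ2EqTFlatOfSymmetry
import HarnessLib

/-!
# Stub `stub_russoMixture` (S5a) of line `Sketch`, crux `LoopLimitZ2EqT` (stmt-CriticalPhenomena-4833)

Russo's formula for the MIXTURE. The segment model `M_t = prodBernoulli (prm t)` puts on every
cell `x` a type bit `(x, none)` of density `t`, a fair coin and three critical bond coins (densities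
independent of `t`). For `δ > 0` the crude crossing event
`E = {S | cfg S ∈ embDomainCrossing triEmbed R.carrier δ (R.arc 0) (R.arc 2)}` is determined by a
finite set of coins (`flatOfSymmetry_determinedBy`), so by the cylinder expansion
`RussoPath.prodBernoulli_real_eq_sum_powerset` the probability `P_t(E)` is a multi-affine
polynomial in the coin densities. Differentiating termwise (product rule) and reading off the
`i`-th partial derivative of a multi-affine polynomial as its difference quotient between
`w_i = 1` and `w_i = 0` gives the general path formula

  `d/db P_{p(b)}(B) = Σ_{i ∈ K} p_i'(b) · (P_{p(b), p_i := 1}(B) − P_{p(b), p_i := 0}(B))`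

(`russoMixture_hasDerivWithinAt`; NO monotonicity of `B` is used — for increasing `B` the bracket
is the pivotal probability and one recovers `hasDerivAt_prodBernoulli_real`). Along the segment
only the type bits move (derivative `1` within `[0,1]`), and cells outside the determining set have
influence `0`, so the `finsum` over all cells of the TYPE INFLUENCES is the derivative of
`t ↦ segCrossℝ t R δ` within `[0,1]`.
-/

noncomputable section

open MeasureTheory Set Filter Metric
open scoped Real Topology BigOperators

namespace Summit.CriticalPhenomena.CardyFormulaZ2.Cruxes.LoopLimitZ2EqT.HexSegment

open Literature.Probability.RandomPlanarGeometry Literature.Probability.Percolation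
  Literature.Probability.LatticeModels

/-! ### Russo's formula along a path, influence form (no monotonicity) -/

/-- The probability of an event determined by `K` only reads the parameters on `K`. -/
theorem russoMixture_real_eq_of_eqOn {ι : Type*} {B : Set (Set ι)} {K : Finset ι}
    (hB : DeterminedBy B (↑K : Set ι)) {q q' : ι → unitInterval} (h : ∀ i ∈ K, q i = q' i) :
    (prodBernoulli q).real B = (prodBernoulli q').real B := by
  classical
  rw [RussoPath.prodBernoulli_real_eq_sum_powerset hB q,
    RussoPath.prodBernoulli_real_eq_sum_powerset hB q']
  refine Finset.sum_congr rfl fun S _ ↦ ?_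
  split_ifs
  · exact Finset.prod_congr rfl fun i hi ↦ by rw [h i hi]
  · rfl

/-- **Russo's formula along a path of parameters, influence form.** Let `B` be ANY event
determined by the finite set `K` (not necessarily increasing), and let the parameters
`p b : ι → [0,1]` have, at every coordinate `i ∈ K`, the derivative `p' i` at `t` within `s`.
Then `b ↦ P_{p(b)}(B)` has, at `t` within `s`, the derivative
`Σ_{i ∈ K} p'_i · (P_{p(t), p_i := 1}(B) − P_{p(t), p_i := 0}(B))`: the cylinder expansion is
multi-affine in the coordinates' densities, and the partial derivative of a multi-affine polynomial
in `w_i` is its difference between `w_i = 1` and `w_i = 0`. -/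
theorem russoMixture_hasDerivWithinAt {ι : Type*} [DecidableEq ι] (p : ℝ → ι → unitInterval)
    {B : Set (Set ι)} {K : Finset ι} (hK : DeterminedBy B (↑K : Set ι)) {s : Set ℝ} {t : ℝ}
    (p' : ι → ℝ) (hp : ∀ i ∈ K, HasDerivWithinAt (fun b ↦ (p b i : ℝ)) (p' i) s t) :
    HasDerivWithinAt (fun b ↦ (prodBernoulli (p b)).real B)
      (∑ i ∈ K, p' i * ((prodBernoulli (Function.update (p t) i 1)).real B -
        (prodBernoulli (Function.update (p t) i 0)).real B)) s t := by
  classical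
  -- the weights and their derivatives
  set w : Finset ι → ι → ℝ → ℝ := fun S i b ↦ if i ∈ S then (p b i : ℝ) else 1 - (p b i : ℝ)
    with hw
  set dw : Finset ι → ι → ℝ := fun S i ↦ if i ∈ S then p' i else -p' i with hdw
  have hwd : ∀ S, ∀ i ∈ K, HasDerivWithinAt (w S i) (dw S i) s t := by
    intro S i hi
    by_cases hiS : i ∈ S
    · have h1 : w S i = fun b ↦ (p b i : ℝ) := by funext b; simp [hw, hiS]
      have h2 : dw S i = p' i := by simp [hdw, hiS]
      rw [h1, h2]; exact hp i hi
    · have h1 : w S i = fun b ↦ 1 - (p b i : ℝ) := by funext b; simp [hw, hiS]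
      have h2 : dw S i = -p' i := by simp [hdw, hiS]
      rw [h1, h2]; exact (hp i hi).const_sub 1
  -- `P_{p(b)}(B)` is the cylinder polynomial
  have hrepr : (fun b ↦ (prodBernoulli (p b)).real B) =
      fun b ↦ ∑ S ∈ K.powerset, if (↑S : Set ι) ∈ B then ∏ i ∈ K, w S i b else 0 := by
    funext b
    rw [RussoPath.prodBernoulli_real_eq_sum_powerset hK (p b)]
  rw [hrepr]
  -- differentiate term by term
  have hderiv : HasDerivWithinAt
      (fun b ↦ ∑ S ∈ K.powerset, if (↑S : Set ι) ∈ B then ∏ i ∈ K, w S i b else 0)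
      (∑ S ∈ K.powerset, if (↑S : Set ι) ∈ B then
        ∑ e ∈ K, (∏ j ∈ K.erase e, w S j t) * dw S e else 0) s t := by
    refine HasDerivWithinAt.fun_sum fun S _ ↦ ?_
    split_ifs with hSB
    · have := HasDerivWithinAt.fun_finsetProd (u := K) (x := t) (s := s)
        (fun i hi ↦ hwd S i hi)
      simpa [smul_eq_mul] using this
    · simpa using hasDerivWithinAt_const t s (0 : ℝ)
  refine hderiv.congr_deriv ?_
  -- exchange the sums
  have hpush : (∑ S ∈ K.powerset, if (↑S : Set ι) ∈ B then
      ∑ e ∈ K, (∏ j ∈ K.erase e, w S j t) * dw S e else 0) =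
      ∑ S ∈ K.powerset, ∑ e ∈ K, (if (↑S : Set ι) ∈ B then
        (∏ j ∈ K.erase e, w S j t) * dw S e else 0) := by
    refine Finset.sum_congr rfl fun S _ ↦ ?_
    split_ifs <;> simp
  rw [hpush, Finset.sum_comm]
  refine Finset.sum_congr rfl fun e he ↦ ?_
  -- the `e`-th term: expand both updated measures over the same cylinders
  rw [RussoPath.prodBernoulli_real_eq_sum_powerset hK (Function.update (p t) e 1),
    RussoPath.prodBernoulli_real_eq_sum_powerset hK (Function.update (p t) e 0),
    ← Finset.sum_sub_distrib, Finset.mul_sum]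
  refine Finset.sum_congr rfl fun S _ ↦ ?_
  by_cases hSB : (↑S : Set ι) ∈ B
  · simp only [if_pos hSB]
    rw [← Finset.mul_prod_erase K _ he, ← Finset.mul_prod_erase K _ he]
    have hoff : ∀ c : unitInterval,
        ∏ j ∈ K.erase e, (if j ∈ S then ((Function.update (p t) e c j : unitInterval) : ℝ)
          else 1 - ((Function.update (p t) e c j : unitInterval) : ℝ)) =
        ∏ j ∈ K.erase e, w S j t := by
      intro c
      refine Finset.prod_congr rfl fun j hj ↦ ?_
      simp [hw, Function.update_of_ne (Finset.ne_of_mem_erase hj)]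
    rw [hoff 1, hoff 0]
    by_cases heS : e ∈ S
    · simp [hdw, heS]
      ring
    · simp [hdw, heS]
      ring
  · simp [hSB]

/-! ### The stub -/

/-- **S5a `stub_russoMixture`: Russo's formula for the mixture.** For `δ > 0` and `t ∈ [0,1]`
the crude crossing probability `t' ↦ segCrossℝ t' R δ` has, within `[0,1]`, the derivative
`∑ᶠ x, (P[F ; type bit of cell x forced present] − P[F ; type bit of cell x forced absent])`:
the finite sum (cells outside the determining set of the crossing event contribute `0`) of the
TYPE INFLUENCES of the cells. Pure multilinearity (`russoMixture_hasDerivWithinAt`), no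
monotonicity. -/
theorem stub_russoMixture :
    ∀ (R : ConformalRectangle) (δ : ℝ), 0 < δ → ∀ t ∈ Set.Icc (0 : ℝ) 1,
      HasDerivWithinAt (fun t' : ℝ ↦ segCrossℝ t' R δ)
        (∑ᶠ x : Site 2,
          ((prodBernoulli (Function.update (prm (Set.projIcc (0 : ℝ) 1 zero_le_one t))
              (x, (none : Option (Option (Fin 3)))) 1)).real
              {S : Set Coin | cfg S ∈ embDomainCrossing triEmbed R.carrier δ (R.arc 0) (R.arc 2)} -
            (prodBernoulli (Function.update (prm (Set.projIcc (0 : ℝ) 1 zero_le_one t))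
              (x, (none : Option (Option (Fin 3)))) 0)).real
              {S : Set Coin | cfg S ∈ embDomainCrossing triEmbed R.carrier δ (R.arc 0) (R.arc 2)}))
        (Set.Icc 0 1) t := by
  intro R δ hδ t ht
  classical
  obtain ⟨K₀, hK₀⟩ := flatOfSymmetry_determinedBy R hδ
  -- enlarge the determining set to a product `K' ×ˢ univ`
  have hsub : (↑K₀ : Set Coin) ⊆ ↑(K₀.image Prod.fst ×ˢ (Finset.univ : Finset (Option (Option (Fin 3))))) := by
    intro i hi
    rw [Finset.mem_coe] at hi
    rw [Finset.mem_coe, Finset.mem_product]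
    exact ⟨Finset.mem_image_of_mem Prod.fst hi, Finset.mem_univ _⟩
  have hK := hK₀.mono hsub
  -- the coordinate derivatives within `[0,1]`: `1` at type bits, `0` elsewhere
  have hp : ∀ i ∈ K₀.image Prod.fst ×ˢ (Finset.univ : Finset (Option (Option (Fin 3)))),
      HasDerivWithinAt (fun b : ℝ ↦ ((prm (Set.projIcc (0 : ℝ) 1 zero_le_one b) i : ℝ)))
        ((fun j : Coin ↦ if j.2 = none then (1 : ℝ) else 0) i) (Icc 0 1) t := by
    intro i _
    obtain ⟨x, c⟩ := i
    rcases c with _ | _ | k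
    · simp only [if_true]
      refine (hasDerivWithinAt_id t (Icc (0 : ℝ) 1)).congr_of_mem (fun b hb ↦ ?_) ht
      simp [prm, Set.projIcc_of_mem zero_le_one hb]
    · simp only [reduceCtorEq, if_false]
      exact (hasDerivWithinAt_const t (Icc (0 : ℝ) 1) ((half : unitInterval) : ℝ)).congr
        (fun b _ ↦ rfl) rfl
    · simp only [reduceCtorEq, if_false]
      exact (hasDerivWithinAt_const t (Icc (0 : ℝ) 1)
        ((criticalWeightI (Real.pi / 6) : unitInterval) : ℝ)).congr (fun b _ ↦ rfl) rfl
  have hmain := russoMixture_hasDerivWithinAt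
    (fun b : ℝ ↦ prm (Set.projIcc (0 : ℝ) 1 zero_le_one b)) hK
    (fun j : Coin ↦ if j.2 = none then (1 : ℝ) else 0) hp
  refine (hmain.congr_deriv ?_).congr (fun b _ ↦ rfl) rfl
  -- identify the derivative: only type bits count, and cells off `K'` have influence `0`
  rw [Finset.sum_product]
  symm
  refine (finsum_eq_sum_of_support_subset _ fun x hx ↦ ?_).trans
    (Finset.sum_congr rfl fun x _ ↦ ?_)
  · -- support ⊆ K'
    rw [Finset.mem_coe]
    by_contra hxK
    refine hx (sub_eq_zero.2 (russoMixture_real_eq_of_eqOn hK fun i hi ↦ ?_))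
    have hne : i ≠ (x, none) := by
      rintro rfl
      exact hxK (Finset.mem_product.1 hi).1
    rw [Function.update_of_ne hne, Function.update_of_ne hne]
  · rw [Fintype.sum_eq_single (none : Option (Option (Fin 3))) fun c hc ↦ by simp [hc]]
    simp

end Summit.CriticalPhenomena.CardyFormulaZ2.Cruxes.LoopLimitZ2EqT.HexSegment

end
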